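/-
Copyright: the b2b-balaban cell (near-miss cell 7), T⁴-continuum fan-out, NE7b ROUND-2 swarm `t4-ne7b-formalise-*`
(seat leaf-07, gen 2), row S6f «window-drop steps in the zone calculus» of lineage t4-ne7b-p1's claim table
`LEAVES-NE7b.md` (R-OWNER-22-2 (U2)).  Part Ib.
Released under the licence of the surrounding project.
-/
import Summits.QuantumFields.BalabanUV.T4Continuum.Support.HistoryLevels
import Summits.QuantumFields.BalabanUV.T4Continuum.Support.HistoryShapeCrowd

/-!
# History levels, Ib: the levelled nearness, its root-position counts, the torus multiplicity AT LEVELS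

Summits-side support leaf of the T⁴-continuum cell (rung (B)+1 on a FINITE torus only; NOT infinite volume, NOT the
mass gap, NOT the Clay statement; NOT a proof of the spine estimate NE7b).  NE7b ROUND-2 swarm, row **S6f** (window-drop
steps; R-OWNER-22-2 (U2)), continuing `Support/HistoryLevels.lean` (level functions `LevelFn`, deflator `theta`, model
scale `levelOf`).  Here the torus side: the cube lattice of step `t` is the level-`lv t` blocking, a zone's missing
contraction at a plateau step is booked by the deflator `θ_t ∈ [ϑ, 1]` of the extent, and `1∕θ_t` goes into the
nearness RADIUS — the root-position count pays `(r∕θ_t + 1)^d ≤ ϑ^{−d}(r+1)^d`, a constant per merger; the blocking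
fibre at levels is free (`LevelFn.sub_le`).  [folklore] finite counting on the lineage's OWN carriers; nothing is quoted
from print, nothing printed is asserted, no `[cite:]` tag, no `Prop` fact minted (`nearD` is a nearness predicate).

WHAT.  §1 **`nearD n L K lv θ`** (`ZoneTorus.nearT` with scales and comparison step read through `lv`, radius `r∕θ t`),
`NZD`, `nearD_id` (`lv = id`, `θ ≡ 1` recovers `nearT`); the binders **`card_nearD_le`**∕**`card_nearD_le'`** (`hN1`∕`hN2`)
and **`NZD_le`** (`hNZ` with `M₀ = 2^d·ϑ^{−d}`).  §2 **`card_admZSet_root_le_torusD`** = `ZoneTorus.card_admZSet_root_le_torus`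
AT LEVELS (generic event type, affine law displayed).  §3 **`card_admZSet_grestrict_leD`** = `HistoryShapeCrowd.
card_admZSet_grestrict_leS` AT LEVELS (tagged genealogy `G : Gen ε`, shape map `sh`):
`#admZSet (nearD …) … ≤ (2^d ϑ^{−d}(C₀+2c₀+1)^d)^{#merges G}·∏_{e ∈ merges G} Q(wcntS sh G,σ,(sh e).step)^d·(L^d)^{partnerAges
(step∘sh) G}` — row S6's consumer shape VERBATIM with `Kz ↦ ϑ^{−d}·Kz`.  Part II (`Support/HistoryZonesDrops.lean`): the
levelled tolerant reading ⇒ these hypotheses.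

HONEST DEPENDENCY (cell): continuum YM on T⁴ ⇐ BetaPertH ∧ nine spine estimates (0/9 proved); BetaPertH ⇐ (D1) ∧ (D4)
∧ CAP+tail; G-an2-4 gates asym, D1 and NE2/3/4.  This file changes none of it.
-/

open Finset
open Literature.MathematicalPhysics.QuantumFieldTheory.Balaban1983to89
open T4PersistenceDictionary T4PartnerMultiplicity
open Summit.QuantumFields.BalabanUV.T4Continuum.PlacementSkeleton
open Summit.QuantumFields.BalabanUV.T4Continuum.Crowding
open Summit.QuantumFields.BalabanUV.T4Continuum.ZoneSkeleton
open Summit.QuantumFields.BalabanUV.T4Continuum.ZoneCrowd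
open Summit.QuantumFields.BalabanUV.T4Continuum.ZoneTorus

namespace Summit.QuantumFields.BalabanUV.T4Continuum.HistoryZones

noncomputable section

/-! ## §1 Levelled nearness with the deflated radius; the root-position counts -/

variable {d : ℕ}

/-- **NEARNESS AT LEVELS**: `ZoneTorus.nearT` with the scales of the two root cells and the comparison step read
through the level function, and the radius INFLATED by the deflator of the comparison step. [folklore] -/
def nearD (n L K : ℕ) (lv : ℕ → ℕ) (θ : ℕ → ℝ) (x : TCell d (n * L ^ K)) (sx : ℕ) (y : TCell d (n * L ^ K))
    (sy t : ℕ) (r : ℝ) : Prop :=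
  nearT n L K x (lv sx) y (lv sy) (lv t) (r / θ t)

/-- THE ROOT-POSITION COUNT AT LEVELS [folklore] -/
def NZD (d L : ℕ) (lv : ℕ → ℕ) (θ : ℕ → ℝ) (r : ℝ) (t s : ℕ) : ℕ := NZT d L (r / θ t) (lv t) (lv s)

/-- the drop-free model with no deflation is the landed nearness [folklore] -/
theorem nearD_id (n L K : ℕ) : nearD (d := d) n L K (fun u => u) (fun _ => 1) = nearT n L K := by
  funext x sx y sy t r
  simp [nearD]

section Counts

open scoped Classical

/-- **`hN1` AT LEVELS** [folklore] -/
theorem card_nearD_le (n : ℕ) {L : ℕ} (hL : 1 ≤ L) (K : ℕ) (lv : ℕ → ℕ) (θ : ℕ → ℝ) (x : TCell d (n * L ^ K))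
    (sx sy t : ℕ) (r : ℝ) :
    ((univ : Finset (TCell d (n * L ^ K))).filter fun y => nearD n L K lv θ x sx y sy t r).card ≤
      NZD d L lv θ r t sy :=
  card_nearT_le n hL K x (lv sx) (lv sy) (lv t) (r / θ t)

/-- **`hN2` AT LEVELS** [folklore] -/
theorem card_nearD_le' (n : ℕ) {L : ℕ} (hL : 1 ≤ L) (K : ℕ) (lv : ℕ → ℕ) (θ : ℕ → ℝ) (y : TCell d (n * L ^ K))
    (sx sy t : ℕ) (r : ℝ) :
    ((univ : Finset (TCell d (n * L ^ K))).filter fun x => nearD n L K lv θ x sx y sy t r).card ≤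
      NZD d L lv θ r t sx :=
  card_nearT_le' n hL K y (lv sx) (lv sy) (lv t) (r / θ t)

end Counts

/-- **`hNZ` AT LEVELS**: for a level function, a deflator with values in `[ϑ, 1]` (`0 < ϑ`) and `r ≥ 0`,
`NZD d L lv θ r t s ≤ 2^d·ϑ^{−d}·(r+1)^d·(L^d)^{t+1−s}` — the landed fibre shape with `M₀ = 2^d·ϑ^{−d}`: the inflated
radius costs the constant `ϑ^{−d}`, the fibre at levels is free (`LevelFn.sub_le`). [folklore] -/
theorem NZD_le {K : ℕ} {lv : ℕ → ℕ} (h : LevelFn K lv) {L : ℕ} (hL : 1 ≤ L) (d : ℕ) {θ : ℕ → ℝ} {ϑ : ℝ}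
    (hϑ : 0 < ϑ) (hθ1 : ∀ t, θ t ≤ 1) (hθ : ∀ t, ϑ ≤ θ t) {r : ℝ} (hr : 0 ≤ r) (t s : ℕ) :
    (NZD d L lv θ r t s : ℝ) ≤ (2 : ℝ) ^ d * ϑ⁻¹ ^ d * (r + 1) ^ d * ((L : ℝ) ^ d) ^ (t + 1 - s) := by
  unfold NZD NZT
  push_cast
  have hθt : 0 < θ t := hϑ.trans_le (hθ t)
  have hr' : 0 ≤ r / θ t := div_nonneg hr hθt.le
  have hϑ1 : ϑ ≤ 1 := (hθ t).trans (hθ1 t)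
  have hinv : 1 ≤ ϑ⁻¹ := (one_le_inv₀ hϑ).2 hϑ1
  have hfl : ((⌊r / θ t⌋₊ : ℕ) : ℝ) ≤ r / θ t := Nat.floor_le hr'
  have hdiv : r / θ t ≤ r / ϑ := div_le_div_of_nonneg_left hr hϑ (hθ t)
  have hbase : (2 : ℝ) * ((⌊r / θ t⌋₊ : ℕ) : ℝ) + 1 ≤ 2 * ϑ⁻¹ * (r + 1) := by
    have e : (2 : ℝ) * ϑ⁻¹ * (r + 1) = 2 * (r / ϑ) + 2 * ϑ⁻¹ := by rw [div_eq_mul_inv]; ring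
    rw [e]
    linarith
  have h1 : ((2 : ℝ) * ((⌊r / θ t⌋₊ : ℕ) : ℝ) + 1) ^ d ≤ (2 : ℝ) ^ d * ϑ⁻¹ ^ d * (r + 1) ^ d :=
    calc ((2 : ℝ) * ((⌊r / θ t⌋₊ : ℕ) : ℝ) + 1) ^ d ≤ (2 * ϑ⁻¹ * (r + 1)) ^ d :=
          pow_le_pow_left₀ (by positivity) hbase d
      _ = (2 : ℝ) ^ d * ϑ⁻¹ ^ d * (r + 1) ^ d := by rw [mul_pow, mul_pow]
  have hL1 : (1 : ℝ) ≤ (L : ℝ) ^ d := one_le_pow₀ (by exact_mod_cast hL)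
  have h2 : ((L : ℝ) ^ d) ^ (lv t - lv s) ≤ ((L : ℝ) ^ d) ^ (t + 1 - s) :=
    pow_le_pow_right₀ hL1 (by have := h.sub_le s t; omega)
  exact mul_le_mul h1 h2 (by positivity) (by positivity)

/-! ## §2 The zone-form multiplicity on the torus AT LEVELS -/

section TorusD

variable {ε : Type*} [DecidableEq ε] [Fintype ε]

open scoped Classical

/-- **THE ZONE-FORM MULTIPLICITY ON THE FINITE TORUS, AT LEVELS (affine contraction law)**:
`ZoneDrivers.card_admZSet_root_le_crowd_affine` with the cell type `TCell d (n·L^K)`, the levelled nearness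
`nearD n L K lv θ` (level function `lv`, deflator `θ` with values in `[ϑ, 1]`, `0 < ϑ`) and the three root-position
binders DISCHARGED (`card_nearD_le`, `card_nearD_le'`, `NZD_le`; `M₀ = 2^d·ϑ^{−d}`, `Λ = L^d`).  Displayed: `ext ≥ 0`
with `ext t X ≤ C₀·qZ wt σ st X t + c₀`, `wt ≥ 1`, `σ ≥ 0`, well-formed `G`. [folklore] -/
theorem card_admZSet_root_le_torusD (W : ε → ℕ) (n : ℕ) {L : ℕ} (hL : 1 ≤ L) (K : ℕ) {lv : ℕ → ℕ}
    (hlv : LevelFn K lv) {θ : ℕ → ℝ} {ϑ : ℝ} (hϑ : 0 < ϑ) (hθ1 : ∀ t, θ t ≤ 1) (hθ : ∀ t, ϑ ≤ θ t)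
    (ext : ℕ → Gen ε → ℝ) (hext0 : ∀ t X, 0 ≤ ext t X) (st : ε → ℕ) {C₀ c₀ σ : ℝ} (hC : 0 ≤ C₀) (hc : 0 ≤ c₀)
    (hσ : 0 ≤ σ) (wt : ε → ℝ) (hwt : ∀ w, 1 ≤ wt w) (hext : ∀ t X, ext t X ≤ C₀ * qZ wt σ st X t + c₀)
    {G : Gen ε} (hW : G.WF W) (c c₀' : TCell d (n * L ^ K)) :
    ((admZSet (nearD n L K lv θ) ext st G G.root c c₀').card : ℝ) ≤ ((L : ℝ) ^ d) ^ partnerAges st G *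
      (((2 : ℝ) ^ d * ϑ⁻¹ ^ d * (C₀ + 2 * c₀ + 1) ^ d) ^ mergeCount G *
        mergeProd (fun Z e => qZ wt σ st Z (st e) ^ d) G) :=
  card_admZSet_root_le_crowd_affine W (nearD n L K lv θ) ext hext0 st (NZD d L lv θ) (by positivity) (by positivity)
    hC hc hσ d (fun x sx sy t r => card_nearD_le n hL K lv θ x sx sy t r)
    (fun y sx sy t r => card_nearD_le' n hL K lv θ y sx sy t r) (fun r t s hr => NZD_le hlv hL d hϑ hθ1 hθ hr t s)
    wt hwt hext hW c c₀'

end TorusD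

/-! ## §3 … along a shape map, with the crowding joint (tagged genealogies) -/

section ShapeD

variable {ε : Type*} [DecidableEq ε] (sh : ε → PEv) (W : ε → ℕ)

open scoped Classical

/-- **THE (GM) MULTIPLICITY FACTOR ON THE TORUS AT LEVELS, ALONG A SHAPE MAP** (`HistoryShapeCrowd.
card_admZSet_grestrict_leS` with `nearT ↦ nearD n L K lv θ`).  For `G : Gen ε` well-formed (`W`), chronological for
`step ∘ sh`, with kind-`0` birth shapes and non-kind-`0` merger shapes, events inside `E`, nonnegative extents under
the affine law `extP t X ≤ C₀·qZ (wtPEv∘sh) σ (step∘sh) X t + c₀` (`C₀, c₀, σ ≥ 0`), a level function `lv` and a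
deflator `θ` with values in `[ϑ, 1]` (`0 < ϑ`): the `nearD`-admissible torus placements of `grestrict E G hE` with the
root piece at `c` number at most
`(2^d·ϑ^{−d}·(C₀+2c₀+1)^d)^{#merges G} · (∏_{e ∈ merges G} Q(wcntS sh G, σ, (sh e).step)^(d:ℝ)) · (L^d)^{partnerAges (step∘sh) G}`.
[folklore] -/
theorem card_admZSet_grestrict_leD (n : ℕ) {L : ℕ} (hL : 1 ≤ L) (K : ℕ) {lv : ℕ → ℕ} (hlv : LevelFn K lv)
    {θ : ℕ → ℝ} {ϑ : ℝ} (hϑ : 0 < ϑ) (hθ1 : ∀ t, θ t ≤ 1) (hθ : ∀ t, ϑ ≤ θ t)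
    (extP : ℕ → Gen ε → ℝ) (hext0 : ∀ t X, 0 ≤ extP t X) {C₀ c₀ σ : ℝ} (hC : 0 ≤ C₀) (hc : 0 ≤ c₀)
    (hσ : 0 ≤ σ) (hext : ∀ t X, extP t X ≤ C₀ * qZ (wtPEv ∘ sh) σ (PEv.step ∘ sh) X t + c₀)
    {G : Gen ε} (hW : G.WF W) (hchr : Chrono (PEv.step ∘ sh) G)
    (hk0 : ∀ b ∈ births G, (sh b).kind = 0) (hk2 : ∀ m ∈ merges G, (sh m).kind ≠ 0)
    (E : Finset ε) (hE : G.events ⊆ E) (c c₀' : TCell d (n * L ^ K)) :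
    ((admZSet (nearD n L K lv θ) (fun t Z => extP t (gmap Subtype.val Z)) ((PEv.step ∘ sh) ∘ Subtype.val)
        (grestrict E G hE) (grestrict E G hE).root c c₀').card : ℝ) ≤
      ((2 : ℝ) ^ d * ϑ⁻¹ ^ d * (C₀ + 2 * c₀ + 1) ^ d) ^ (merges G).card *
        (∏ e ∈ merges G, Q (wcntS sh G) σ (sh e).step ^ (d : ℝ)) *
          ((L : ℝ) ^ d) ^ partnerAges (PEv.step ∘ sh) G := by
  set G' := grestrict E G hE with hG'
  have hGG : gmap Subtype.val G' = G := gmap_grestrict E G hE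
  have hinj : Function.Injective (Subtype.val : ↥E → ε) := Subtype.val_injective
  have hq : ∀ (Z : Gen ↥E) (t : ℕ), qZ (wtPEv ∘ sh) σ (PEv.step ∘ sh) (gmap Subtype.val Z) t =
      qZ ((wtPEv ∘ sh) ∘ Subtype.val) σ ((PEv.step ∘ sh) ∘ Subtype.val) Z t := fun Z t =>
    qZ_gmap hinj (wtPEv ∘ sh) σ (PEv.step ∘ sh) Z t
  have hext' : ∀ (t : ℕ) (Z : Gen ↥E), extP t (gmap Subtype.val Z) ≤
      C₀ * qZ ((wtPEv ∘ sh) ∘ Subtype.val) σ ((PEv.step ∘ sh) ∘ Subtype.val) Z t + c₀ := fun t Z => by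
    rw [← hq]; exact hext t _
  -- (1) the torus count at levels on the finite alphabet
  have h1 := card_admZSet_root_le_torusD (W ∘ Subtype.val) n hL K hlv hϑ hθ1 hθ
    (fun t Z => extP t (gmap Subtype.val Z)) (fun t Z => hext0 t _) ((PEv.step ∘ sh) ∘ Subtype.val) hC hc hσ
    ((wtPEv ∘ sh) ∘ Subtype.val) (fun w => one_le_wtPEv (sh w.1)) hext' (wf_grestrict W E G hE hW) c c₀'
  -- (2) transport of the three structural quantities to `G = gmap val G'`
  have hpa : partnerAges ((PEv.step ∘ sh) ∘ Subtype.val) G' = partnerAges (PEv.step ∘ sh) G := by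
    rw [← hGG, partnerAges_gmap]
  have hmc : mergeCount G' = mergeCount G := by rw [← hGG, mergeCount_gmap]
  have hmp : mergeProd (fun Z e => qZ ((wtPEv ∘ sh) ∘ Subtype.val) σ ((PEv.step ∘ sh) ∘ Subtype.val) Z
        (((PEv.step ∘ sh) ∘ Subtype.val) e) ^ d) G' =
      mergeProd (fun Z e => qZ (wtPEv ∘ sh) σ (PEv.step ∘ sh) Z ((PEv.step ∘ sh) e) ^ d) G := by
    rw [← hGG, mergeProd_gmap]
    congr 1
    funext Z e
    rw [hq]
    rfl
  rw [hpa, hmc, hmp] at h1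
  -- (3) the crowding joint along `sh`
  have h2 := zoneFactor_le_prod_QS sh W hW hk0 hk2 hchr hσ (M₀ := (2 : ℝ) ^ d * ϑ⁻¹ ^ d) (C₀ := C₀ + 2 * c₀)
    (by positivity) (by positivity) d
  calc ((admZSet (nearD n L K lv θ) (fun t Z => extP t (gmap Subtype.val Z)) ((PEv.step ∘ sh) ∘ Subtype.val)
          G' G'.root c c₀').card : ℝ)
      ≤ ((L : ℝ) ^ d) ^ partnerAges (PEv.step ∘ sh) G *
          (((2 : ℝ) ^ d * ϑ⁻¹ ^ d * (C₀ + 2 * c₀ + 1) ^ d) ^ mergeCount G *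
            mergeProd (fun Z e => qZ (wtPEv ∘ sh) σ (PEv.step ∘ sh) Z ((PEv.step ∘ sh) e) ^ d) G) := h1
    _ ≤ ((L : ℝ) ^ d) ^ partnerAges (PEv.step ∘ sh) G *
          (((2 : ℝ) ^ d * ϑ⁻¹ ^ d * (C₀ + 2 * c₀ + 1) ^ d) ^ (merges G).card *
            ∏ e ∈ merges G, Q (wcntS sh G) σ (sh e).step ^ (d : ℝ)) :=
        mul_le_mul_of_nonneg_left h2 (by positivity)
    _ = _ := by ring

end ShapeD

/-! ## §4 Sanity -/

namespace SanityLT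

/-- with the drop-free level function and no deflation the count at levels is the landed `NZT` -/
example (L : ℕ) (r : ℝ) (t s : ℕ) : NZD 4 L (fun u => u) (fun _ => 1) r t s = NZT 4 L r t s := by simp [NZD]

end SanityLT

end

end Summit.QuantumFields.BalabanUV.T4Continuum.HistoryZones
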